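import Summits.RiemannHypothesis.RiemannHypothesis.Theses.UniversalFactor
import Literature.NumberTheory.LFunctions.DeBruijnHDiv
import Summits.RiemannHypothesis.RiemannHypothesis.Theorems.UniversalFactorLaguerreLift

/-!
# Sketch (crux-ideate round 1, ideator 3, gen 2) — `NarrowKernelNoGo` (stmt-RiemannHypothesis-2576)

Card `leibniz-tail-lobe-area`: under LP(F_a) the FORWARD Laplace tail
`Q_a(x) = ∫₀^∞ H_0(x+y) e^{-ay} dy` (`= (F_a' + aF_a)/a²`, tree `deriv_add_mul_eq_forward`)
alternates in sign along CONSECUTIVE real zeros of `H_0` (the zeros of `H_0` are exactly the critical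
points of `x ↦ e^{-ax} Q_a(x)`, and `|e^{-ax}(F_a'+aF_a)|` is strictly log-concave on zero-free
intervals under LP: `strictAntiOn_re_logDeriv` + Rolle), hence the pointwise domination
`|Q_a(u)| ≤ A(u) + A⁺(u)` by the `L¹`-areas of the two adjacent lobes of `Ξ`; squared and integrated
this loses against the mean square of `Q_a` once `¼ log(T/4π) ≫ a^5`.
Card `crossover-height-lift`: under LP, `y ↦ |F_a(x+iy)|` is non-decreasing; it fails at the
head/band crossover height `y ≍ log log T / log T`.
Only SIGNATURES are claimed to elaborate; `narrow_of_tail`, `narrow_of_lift` are the checked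
compositions (RH-free: it enters nowhere; LP(F_a) is the absurd hypothesis).
-/

noncomputable section

open Complex MeasureTheory Set

namespace Summit.RiemannHypothesis.RiemannHypothesis.Cruxes.NarrowKernelNoGo.SketchIdeator3G2

open Literature.NumberTheory.LFunctions
open Summit.RiemannHypothesis.RiemannHypothesis.Theses.UniversalFactor

/-- `F_a = deBruijnHDiv (1 + u²/a²)` (the crux's inlined integral, by `rfl`). [folklore] -/
abbrev F (a : ℝ) : ℂ → ℂ := deBruijnHDiv fun u : ℝ => 1 + u ^ 2 / a ^ 2

/-- The forward Laplace tail `Q_a(x) = ∫₀^∞ H_0(x + y) e^{-ay} dy` (a real number for real `x`;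
`F_a'(x) + a F_a(x) = a² Q_a(x)` for `x ≥ 0` by `Theorems.UniversalFactor.deriv_add_mul_eq_forward`). [folklore] -/
def fwdTail (a x : ℝ) : ℝ :=
  (∫ y in Ioi (0:ℝ), deBruijnH 0 ((x : ℂ) + y) * (Real.exp (-(a * y)) : ℂ)).re

/-- `x₁ < x₂` are CONSECUTIVE real zeros of `H_0 = ξ(1/2 + ix/2)/8`. [folklore] -/
def Consecutive (x₁ x₂ : ℝ) : Prop :=
  x₁ < x₂ ∧ deBruijnH 0 x₁ = 0 ∧ deBruijnH 0 x₂ = 0 ∧ ∀ x ∈ Ioo x₁ x₂, deBruijnH 0 x ≠ 0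

/-- `L¹`-area of the lobe of `Ξ` between `x₁` and `x₂`: `∫_{x₁}^{x₂} |H_0(t)| dt`. [folklore] -/
def lobeArea (x₁ x₂ : ℝ) : ℝ :=
  ∫ t in x₁..x₂, |(deBruijnH 0 t).re|

/-- `e^{-a(t-x₁)}`-weighted signed lobe integral `|∫_{x₁}^{x₂} H_0(t) e^{-a(t-x₁)} dt|`. [folklore] -/
def wLobeArea (a x₁ x₂ : ℝ) : ℝ :=
  |∫ t in x₁..x₂, (deBruijnH 0 t).re * Real.exp (-(a * (t - x₁)))|

/-- **FIRST LEMMA (alternation of the forward tail).** If `F_a` has only real zeros then at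
consecutive real zeros `0 ≤ x₁ < x₂` of `H_0` the forward tails have opposite (weak) signs:
`Q_a(x₁) · Q_a(x₂) ≤ 0`. Proof sketch (M): `G := F_a' + aF_a` has only real zeros (`laguerre_step`),
`g := e^{-ax} G = a² e^{-ax} Q_a` has `g' = -a² e^{-ax} H_0` and `Re(G'/G) - a` strictly decreasing
on zero-free intervals (`strictAntiOn_re_logDeriv`); two critical points of `g` in one zero-free
interval are impossible, and an interior minimum `≤ 0 < g(x₁), g(x₂)` puts a zero of `g' ∝ H_0`
strictly inside `(x₁, x₂)`. [folklore] -/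
def TailAlternation : Prop :=
  ∀ a : ℝ, 0 < a → HasOnlyRealZeros (F a) →
    ∀ x₁ x₂ : ℝ, 0 ≤ x₁ → Consecutive x₁ x₂ → fwdTail a x₁ * fwdTail a x₂ ≤ 0

/-- **Pointwise domination (S, from `TailAlternation` by the Leibniz recursion
`Q(x_k) = ∫_{lobe k} H_0 e^{-a(t-x_k)} + e^{-a g_k} Q(x_{k+1})`):** under LP(F_a), for `u` in the lobe
`[x₁, x₂)` followed by the lobe `(x₂, x₃)`: `|Q_a(u)| ≤ ∫_{x₁}^{x₂}|H_0| + ∫_{x₂}^{x₃}|H_0|`. [folklore] -/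
def TailDomination : Prop :=
  ∀ a : ℝ, 0 < a → HasOnlyRealZeros (F a) →
    ∀ u x₁ x₂ x₃ : ℝ, 0 ≤ x₁ → x₁ ≤ u → u < x₂ → Consecutive x₁ x₂ → Consecutive x₂ x₃ →
      |fwdTail a u| ≤ lobeArea x₁ x₂ + lobeArea x₂ x₃

/-- **The arithmetic half (L–XL): domination fails somewhere, for every `a ≥ 32`.** Cashed in
`L²[T,2T]`: `∫Q_a² ≳ (2π/a)∫A²` (mean square of the forward-smoothed `Ξ`, log-free) against
`∫(A+A⁺)² ≲ (4π/log T)²·λ²·∫H_0²` on normal lobes (Cauchy–Schwarz per lobe) plus a long-lobe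
remainder (Fujii's fourth moment of `S(t+h)-S(t)`, in tree, + a fourth-moment bound for `Q_a`,
kurtosis `≍ a log T`; or Ingham + Tsang), contradiction once `log T ≫ a^5`. [folklore] -/
def DominationFails : Prop :=
  ∀ a : ℝ, 32 ≤ a →
    ∃ u x₁ x₂ x₃ : ℝ, 0 ≤ x₁ ∧ x₁ ≤ u ∧ u < x₂ ∧ Consecutive x₁ x₂ ∧ Consecutive x₂ x₃ ∧
      lobeArea x₁ x₂ + lobeArea x₂ x₃ < |fwdTail a u|

/-- **Checked composition.** Domination under LP + its failure ⇒ the crux (no RH needed). -/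
theorem narrow_of_tail (hD : TailDomination) (hF : DominationFails) : NarrowKernelNoGo := by
  intro a ha hLP
  obtain ⟨u, x₁, x₂, x₃, h₁, h₂, h₃, h₄, h₅, hlt⟩ := hF a ha
  have := hD a (by linarith) hLP u x₁ x₂ x₃ h₁ h₂ h₃ h₄ h₅
  linarith

/-- **Three-lobe certificate (S, corollary of `TailAlternation`; the medium-window / `crux_at_32`
reading of the lever).** Four consecutive zeros `0 ≤ x₀ < x₁ < x₂ < x₃` of `H_0` with weighted lobe
integrals `B₀, B₁, B₂` satisfying `e^{a(x₁-x₀)} B₀ + e^{-a(x₂-x₁)} B₂ < B₁` refute LP(F_a): no value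
of `F_a` is needed, only three integrals of `Ξ·e^{-a·}` between consecutive zeros. [folklore] -/
def ThreeLobeCertificate : Prop :=
  ∀ a : ℝ, 0 < a → ∀ x₀ x₁ x₂ x₃ : ℝ, 0 ≤ x₀ →
    Consecutive x₀ x₁ → Consecutive x₁ x₂ → Consecutive x₂ x₃ →
    Real.exp (a * (x₁ - x₀)) * wLobeArea a x₀ x₁ + Real.exp (-(a * (x₂ - x₁))) * wLobeArea a x₂ x₃
        < wLobeArea a x₁ x₂ →
      ¬ HasOnlyRealZeros (F a)

/-- Squared envelope of `H_0` on the real axis: `|H_0(x)| ≍ x^{7/4} e^{-πx/8} |Z(x/2)|`, so mean values are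
taken for `H_0²/envSq ≍ Z²` and `Q_a²/envSq` (raw integrals over `[T,2T]` would only see `t ≈ T`). [folklore] -/
def envSq (x : ℝ) : ℝ :=
  x ^ (7 / 2 : ℝ) * Real.exp (-(Real.pi * x / 4))

/-- Envelope-normalised mean square of the forward tail on `[T, 2T]`. [folklore] -/
def tailEnergy (a T : ℝ) : ℝ :=
  ∫ u in T..2 * T, fwdTail a u ^ 2 / envSq u

/-- **Analytic input 1 (L): the forward-smoothed `Ξ` keeps a `1/(a log T)` fraction of the energy**
(true constant `2π/(a log(T/4π))`: Lorentzian `|1/(a - if)|²` against the flat RS spectrum on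
`f ∈ [0, ¼log(T/4π)]`; Hardy–Littlewood AFE + Montgomery–Vaughan, block-frozen weights). [folklore] -/
def TailEnergyLower : Prop :=
  ∀ a : ℝ, 32 ≤ a → ∀ᶠ T : ℝ in Filter.atTop,
    1 / (a * Real.log T) * ∫ t in T..2 * T, (deBruijnH 0 t).re ^ 2 / envSq t ≤ tailEnergy a T

/-- **FIRST LEMMA of card `crossover-height-lift` (S/M, Hadamard-free in tree:
`strictMonoOn_norm_sq_vertical`-type).** If the even real entire function `F_a` (order `< 2`) has only
real zeros then `y ↦ |F_a(x + iy)|` is non-decreasing on `y ≥ 0`: `|F_a(x)| ≤ |F_a(x + iy)|`. [folklore] -/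
def VerticalLift : Prop :=
  ∀ a : ℝ, 0 < a → HasOnlyRealZeros (F a) → ∀ x y : ℝ, ‖F a x‖ ≤ ‖F a (x + y * I)‖

/-- **The arithmetic half of the lift (XL): at the head/band crossover height the lift fails.**
For every `a ≥ 32` some `x` (indeed a positive proportion of `x ∈ [T,2T]`, `log T ≫ a log a`) and
some `0 < y < 1` (`y ≈ (1.5 log L)/L`, `L = ¼log(T/4π)`) have `|F_a(x+iy)| < |F_a(x)|`: the head
`(a²/L²)e^{Ly} e^{-iφ₁(x)} ζ-proxy` is anti-aligned with the real band value on a positive-measure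
set (joint law: short Euler product ⊗ band sum ⊗ rotation, by mixed moments). [folklore] -/
def LiftFails : Prop :=
  ∀ a : ℝ, 32 ≤ a → ∃ x y : ℝ, ‖F a (x + y * I)‖ < ‖F a x‖

/-- **Checked composition** for the lift card. -/
theorem narrow_of_lift (hV : VerticalLift) (hL : LiftFails) : NarrowKernelNoGo := by
  intro a ha hLP
  obtain ⟨x, y, hlt⟩ := hL a ha
  have := hV a (by linarith) hLP x y
  linarith

end Summit.RiemannHypothesis.RiemannHypothesis.Cruxes.NarrowKernelNoGo.SketchIdeator3G2
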